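import Summits.HodgeConjecture.HodgeConjecture.Theses.TropicalWeilObstruction
import Summits.HodgeConjecture.HodgeConjecture.Theorems.TropicalWeilObstructionTropicalWeilVanishingClassPositivityAllPeriods
import HarnessLib

/-!
# Route `TropicalWeilObstruction` (Kontsevich's tropical test — NEGATION SINK, exploration, no summit claim):
# class positivity is exhausted by the calibration cone at every Weil period (III) — integer versus real frames

Negation-sink bookkeeping of the cell `pub-hodge-tropical` (seat tropical-2 gen 5). Part III of three. Parts I–II
(`…ClassPositivityTransport`, `…ClassPositivityAllPeriods`) proved that a linear functional on the class space which is
`≥ 0` on the square `p_F ⊗ p_F` of the Plücker vector of every REAL `8 × 4` matrix `F` is `≥ 0` on the boundary ray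
`8 θ₄(Q) + Re w(Q)` of the calibration cone at every Weil period `Q`. The class-level positivity constraints that
effectivity actually supplies (tropical-1's `Kappa.nonneg_cyc_of_nonneg_frameSquares`, p337681) are the functionals
`≥ 0` on the squares of SATURATED INTEGER frames (the frames of cells). This part closes the gap:

* `exists_saturated_mul_of_pluckerCoord_ne_zero` — an integer `8 × 4` matrix `L` with a non-zero `4 × 4` minor factors
  as `L = L' · N` with `L'` SATURATED (integer left inverse) and `N` an integer `4 × 4` matrix: a basis of the column
  lattice in Smith normal form (Mathlib `Submodule.smithNormalForm`) sits inside a basis of `ℤ⁸`.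
* `nonneg_intFrameSquare_of_nonneg_frameSquares` — hence a functional `≥ 0` on saturated frame squares is `≥ 0` on
  the square of every integer frame (`p_L = det N · p_{L'}`, or `p_L = 0`);
* `nonneg_realFrameSquare_of_nonneg_frameSquares` — and, clearing denominators and by density of rational matrices
  (continuity of `F ↦ Φ(p_F ⊗ p_F)`), `≥ 0` on the square of every real frame;
* `nonneg_boundaryRay_of_nonneg_frameSquares_allPeriods` — COROLLARY: every linear functional `≥ 0` on all saturated
  integer frame squares — i.e. every class-level necessary condition for effectivity, at every period — is `≥ 0` on
  `8 θ₄(Q) + Re w(Q)` for EVERY positive definite `Q` commuting with `J`. This is tropical-1's `Q = 1` theorem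
  `Kappa.nonneg_boundaryRay_of_nonneg_frameSquares` at all Weil periods, with the same hypothesis verbatim: at the very
  general periods of K1 no class-positivity argument proves K1 or narrows the calibration cone.

HONEST STATUS. Lattice bookkeeping + topology (Mathlib); decides nothing about K1 (a statement about the balanced TYPE)
or about the Hodge conjecture. No definition, no named fact, no sorry.
References: [Zharkov2020TropicalWeil] I. Zharkov, arXiv:2002.02347, §2 (pp. 2–4); [MikhalkinZharkov2014Eigenwave]
G. Mikhalkin, I. Zharkov, LN UMI 15 (2014), Def. 4.2 (saturated frames), Prop. 4.3; [BlekhermanSmithVelasco2016]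
G. Blekherman, G. G. Smith, M. Velasco, JAMS 29 (2016), Thm. 1.1.
-/

set_option linter.dupNamespace false

noncomputable section

open scoped BigOperators
open Matrix
open Literature.AlgebraicGeometry.Tropical
open Summit.HodgeConjecture.HodgeConjecture.Theorems.TropicalHodgeBound

namespace Summit.HodgeConjecture.HodgeConjecture.Theorems.TropicalWeilVanishing.Kappa

/-! ## §0 Display-only notation (verbatim bodies of Parts I–II; nothing is defined) -/

/-- The skeleton's `thetaClass n Q`. -/
local notation3 (prettyPrint := false) "θ⟦" n "⟧" Q:max =>
  (fun S S' : Fin n → Fin (2 * n) => Matrix.det (Matrix.submatrix Q S S'))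

/-- The skeleton's `omegaFrame n` (`Ω = Pᴴ`). -/
local notation3 (prettyPrint := false) "Ω⟦" n "⟧" =>
  (Matrix.of fun (a : Fin (2 * n)) (b : Fin n) =>
    (if (a : ℕ) = (b : ℕ) then (1 : ℂ) else 0) - (if (a : ℕ) = (b : ℕ) + n then Complex.I else 0))

/-- The skeleton's `weilClassC n Q` (`w(Q) = (⋀ⁿQ ⊗ 1)(Ω ⊗ Ω)`). -/
local notation3 (prettyPrint := false) "wC⟦" n "⟧" Q:max =>
  (fun S S' : Fin n → Fin (2 * n) =>
    Matrix.det (Matrix.submatrix (Matrix.map Q ((↑) : ℝ → ℂ) * Ω⟦n⟧) S id) *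
      Matrix.det (Matrix.submatrix (Ω⟦n⟧) S' id))

/-- The skeleton's `weilClassRe n Q` (`w₁ = Re w`). -/
local notation3 (prettyPrint := false) "wRe⟦" n "⟧" Q:max =>
  (fun S S' : Fin n → Fin (2 * n) => Complex.re ((wC⟦n⟧ Q) S S'))

/-- The square `p_F ⊗ p_F` of the Plücker vector of a real `8 × 4` matrix `F` (Part I's display notation). -/
local notation3 (prettyPrint := false) "sq⟦" F "⟧" =>
  (fun S S' : Fin 4 → Fin (2 * 4) =>
    Matrix.det (Matrix.submatrix F S id) * Matrix.det (Matrix.submatrix F S' id))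

/-! ## §1 Saturation: an integer frame of rank `4` is a saturated frame times an integer matrix -/

/-- **Saturation of an integer frame.** If an integer `8 × 4` matrix `L` has a non-zero `4 × 4` minor, then
`L = L' · N` with `L'` an integer `8 × 4` matrix admitting an integer left inverse (a SATURATED frame: its columns
extend to a basis of `ℤ⁸`) and `N` an integer `4 × 4` matrix. (Smith normal form of the column lattice of `L` inside
`ℤ⁸`: a basis `a_i b_{f(i)}` of the lattice with `(b_j)` a basis of `ℤ⁸`; `L' = (b_{f(0)} | … | b_{f(3)})`.)
[cite: MikhalkinZharkov2014Eigenwave, Def. 4.2] -/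
theorem exists_saturated_mul_of_pluckerCoord_ne_zero (L : Matrix (Fin (2 * 4)) (Fin 4) ℤ)
    (S₀ : Fin 4 → Fin (2 * 4)) (hS₀ : pluckerCoord L S₀ ≠ 0) :
    ∃ (L' : Matrix (Fin (2 * 4)) (Fin 4) ℤ) (N : Matrix (Fin 4) (Fin 4) ℤ),
      (∃ M : Matrix (Fin 4) (Fin (2 * 4)) ℤ, M * L' = 1) ∧ L = L' * N := by
  classical
  -- the columns of `L` and their linear independence
  let col : Fin 4 → (Fin (2 * 4) → ℤ) := fun j a => L a j
  have hli : LinearIndependent ℤ col := by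
    rw [Fintype.linearIndependent_iff]
    intro g hg j
    have hmv : (L.submatrix S₀ id) *ᵥ g = 0 := by
      funext k
      have := congrFun hg (S₀ k)
      simp only [Finset.sum_apply, Pi.smul_apply, smul_eq_mul, Pi.zero_apply] at this
      simp only [Matrix.mulVec, dotProduct, Matrix.submatrix_apply, id_eq, Pi.zero_apply]
      rw [← this]
      exact Finset.sum_congr rfl fun i _ => mul_comm _ _
    have h0 := Matrix.eq_zero_of_mulVec_eq_zero (by exact hS₀) hmv
    exact congrFun h0 j
  -- Smith normal form of the column lattice
  let N : Submodule ℤ (Fin (2 * 4) → ℤ) := Submodule.span ℤ (Set.range col)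
  obtain ⟨n, snf⟩ := Submodule.smithNormalForm (Pi.basisFun ℤ (Fin (2 * 4))) N
  have hn : n = 4 := by
    have h1 : Module.finrank ℤ N = 4 := by
      rw [finrank_span_eq_card hli, Fintype.card_fin]
    have h2 : Module.finrank ℤ N = n := by
      rw [Module.finrank_eq_card_basis snf.bN, Fintype.card_fin]
    omega
  subst hn
  -- the saturated frame: the basis vectors `b_{f(i)}` of `ℤ⁸`
  let L' : Matrix (Fin (2 * 4)) (Fin 4) ℤ := fun a i => snf.bM (snf.f i) a
  let M' : Matrix (Fin 4) (Fin (2 * 4)) ℤ := fun i a => snf.bM.repr (Pi.basisFun ℤ (Fin (2 * 4)) a) (snf.f i)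
  have hML : M' * L' = 1 := by
    ext i i'
    have hx : snf.bM (snf.f i') = ∑ a, (snf.bM (snf.f i') a) • (Pi.basisFun ℤ (Fin (2 * 4)) a) := by
      conv_lhs => rw [← (Pi.basisFun ℤ (Fin (2 * 4))).sum_repr (snf.bM (snf.f i'))]
      simp only [Pi.basisFun_repr]
    have hrepr : snf.bM.repr (snf.bM (snf.f i')) (snf.f i) =
        ∑ a, snf.bM (snf.f i') a * snf.bM.repr (Pi.basisFun ℤ (Fin (2 * 4)) a) (snf.f i) := by
      conv_lhs => rw [hx]
      simp only [map_sum, map_smul, Finsupp.coe_finsetSum, Finsupp.coe_smul, Finset.sum_apply,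
        Pi.smul_apply, smul_eq_mul]
    rw [Matrix.mul_apply, Matrix.one_apply]
    calc ∑ a, M' i a * L' a i' = ∑ a, snf.bM (snf.f i') a * snf.bM.repr (Pi.basisFun ℤ (Fin (2 * 4)) a) (snf.f i) :=
          Finset.sum_congr rfl fun a _ => mul_comm _ _
      _ = snf.bM.repr (snf.bM (snf.f i')) (snf.f i) := hrepr.symm
      _ = if i = i' then 1 else 0 := by
          rw [snf.bM.repr_self, Finsupp.single_apply]
          by_cases h : i = i'
          · subst h; simp
          · have h' : snf.f i' ≠ snf.f i := fun e => h (snf.f.injective e).symm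
            simp [h, h']
  -- the coefficient matrix: column `c` of `L` in the basis `a_i b_{f(i)}` of the lattice
  have hmem : ∀ c, col c ∈ N := fun c => Submodule.subset_span ⟨c, rfl⟩
  let N₀ : Matrix (Fin 4) (Fin 4) ℤ := fun i c => snf.a i * snf.bN.repr ⟨col c, hmem c⟩ i
  have hLN : L = L' * N₀ := by
    ext a c
    have hsum := snf.bN.sum_repr ⟨col c, hmem c⟩
    have hcoe : col c = ∑ i, (snf.bN.repr ⟨col c, hmem c⟩ i) • ((snf.bN i : N) : Fin (2 * 4) → ℤ) := by
      conv_lhs => rw [show col c = ((⟨col c, hmem c⟩ : N) : Fin (2 * 4) → ℤ) from rfl, ← hsum]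
      simp only [Submodule.coe_sum, Submodule.coe_smul_of_tower]
    have hc := congrFun hcoe a
    simp only [Finset.sum_apply, Pi.smul_apply, smul_eq_mul] at hc
    rw [show L a c = col c a from rfl, hc, Matrix.mul_apply]
    refine Finset.sum_congr rfl fun i _ => ?_
    have hs := congrFun (snf.snf i) a
    simp only [Pi.smul_apply, smul_eq_mul] at hs
    rw [hs]
    ring
  exact ⟨L', N₀, ⟨M', hML⟩, hLN⟩

/-! ## §2 From saturated integer frames to integer frames to real frames -/

/-- The square of the Plücker vector of an integer frame, as a real table, in the `sq` notation. [folklore] -/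
theorem frameSquare_eq_sq (L : Matrix (Fin (2 * 4)) (Fin 4) ℤ) :
    (fun S S' : Fin 4 → Fin (2 * 4) => ((pluckerCoord L S : ℤ) : ℝ) * ((pluckerCoord L S' : ℤ) : ℝ)) =
      sq⟦L.map ((↑) : ℤ → ℝ)⟧ := by
  funext S S'
  rw [pluckerCoord, pluckerCoord, Int.cast_det, Int.cast_det]
  rfl

/-- **Integer frames.** A linear functional `≥ 0` on the squares of saturated integer frames is `≥ 0` on the square of
every integer `8 × 4` matrix: either all its `4 × 4` minors vanish (square `= 0`), or `L = L'·N` with `L'` saturated and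
`p_L ⊗ p_L = (det N)² · p_{L'} ⊗ p_{L'}`. [cite: MikhalkinZharkov2014Eigenwave, Def. 4.2, Prop. 4.3] -/
theorem nonneg_intFrameSquare_of_nonneg_frameSquares
    (Φ : ((Fin 4 → Fin (2 * 4)) → (Fin 4 → Fin (2 * 4)) → ℝ) →ₗ[ℝ] ℝ)
    (hΦ : ∀ L : Matrix (Fin (2 * 4)) (Fin 4) ℤ, (∃ M : Matrix (Fin 4) (Fin (2 * 4)) ℤ, M * L = 1) →
      0 ≤ Φ (fun S S' => ((pluckerCoord L S : ℤ) : ℝ) * ((pluckerCoord L S' : ℤ) : ℝ)))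
    (L : Matrix (Fin (2 * 4)) (Fin 4) ℤ) :
    0 ≤ Φ (sq⟦L.map ((↑) : ℤ → ℝ)⟧) := by
  by_cases h0 : ∀ S : Fin 4 → Fin (2 * 4), pluckerCoord L S = 0
  · have hz : sq⟦L.map ((↑) : ℤ → ℝ)⟧ = 0 := by
      rw [← frameSquare_eq_sq]
      funext S S'
      rw [h0 S]
      simp
    rw [hz, map_zero]
  · push Not at h0
    obtain ⟨S₀, hS₀⟩ := h0
    obtain ⟨L', N, hsat, hLN⟩ := exists_saturated_mul_of_pluckerCoord_ne_zero L S₀ hS₀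
    have hdet : ∀ S : Fin 4 → Fin (2 * 4), pluckerCoord L S = pluckerCoord L' S * N.det := by
      intro S
      rw [pluckerCoord, pluckerCoord, hLN, ← Matrix.det_mul]
      rfl
    have hsq : sq⟦L.map ((↑) : ℤ → ℝ)⟧ = ((N.det : ℤ) : ℝ) ^ 2 •
        fun S S' : Fin 4 → Fin (2 * 4) => ((pluckerCoord L' S : ℤ) : ℝ) * ((pluckerCoord L' S' : ℤ) : ℝ) := by
      rw [← frameSquare_eq_sq]
      funext S S'
      simp only [Pi.smul_apply, smul_eq_mul, hdet]
      push_cast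
      ring
    rw [hsq, map_smul, smul_eq_mul]
    exact mul_nonneg (sq_nonneg _) (hΦ L' hsat)

/-- Clearing denominators: a rational `8 × 4` matrix is `(1/d) · L` with `L` integer, `d` a positive integer. [folklore] -/
theorem exists_eq_smul_intCast_of_rat (M : Matrix (Fin (2 * 4)) (Fin 4) ℚ) :
    ∃ (d : ℕ) (L : Matrix (Fin (2 * 4)) (Fin 4) ℤ), 0 < d ∧
      M.map ((↑) : ℚ → ℝ) = ((d : ℝ))⁻¹ • (L.map ((↑) : ℤ → ℝ)) := by
  classical
  let d : ℕ := ∏ a : Fin (2 * 4), ∏ j : Fin 4, (M a j).den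
  have hdpos : 0 < d := Finset.prod_pos fun a _ => Finset.prod_pos fun j _ => (M a j).den_pos
  have hdvd : ∀ a j, (M a j).den ∣ d := by
    intro a j
    exact (Finset.dvd_prod_of_mem (fun j => (M a j).den) (Finset.mem_univ j)).trans
      (Finset.dvd_prod_of_mem (fun a => ∏ j : Fin 4, (M a j).den) (Finset.mem_univ a))
  let L : Matrix (Fin (2 * 4)) (Fin 4) ℤ := fun a j => ((d / (M a j).den : ℕ) : ℤ) * (M a j).num
  have hL : ∀ a j, ((L a j : ℤ) : ℚ) = (d : ℚ) * M a j := by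
    intro a j
    obtain ⟨k, hk⟩ := hdvd a j
    have hden : (M a j).den ≠ 0 := (M a j).den_pos.ne'
    have hk' : d / (M a j).den = k := by
      rw [hk, Nat.mul_div_cancel_left _ (Nat.pos_of_ne_zero hden)]
    show (((((d / (M a j).den : ℕ) : ℤ) * (M a j).num : ℤ)) : ℚ) = (d : ℚ) * M a j
    rw [hk']
    push_cast
    rw [hk]
    push_cast
    have hq := Rat.num_div_den (M a j)
    have hden' : ((M a j).den : ℚ) ≠ 0 := by exact_mod_cast hden
    calc (k : ℚ) * ((M a j).num : ℚ) = (k : ℚ) * (((M a j).num : ℚ) / (M a j).den * (M a j).den) := by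
          rw [div_mul_cancel₀ _ hden']
      _ = ((M a j).den : ℚ) * k * M a j := by rw [hq]; ring
  refine ⟨d, L, hdpos, ?_⟩
  ext a j
  simp only [Matrix.map_apply, Matrix.smul_apply, smul_eq_mul]
  have hd0 : (d : ℝ) ≠ 0 := by exact_mod_cast hdpos.ne'
  have e : ((L a j : ℤ) : ℝ) = (d : ℝ) * ((M a j : ℚ) : ℝ) := by
    have := congrArg ((↑) : ℚ → ℝ) (hL a j)
    push_cast at this
    exact this
  rw [e, ← mul_assoc, inv_mul_cancel₀ hd0, one_mul]

/-- Scaling a frame scales the square of its Plücker vector by the eighth power. [folklore] -/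
theorem sq_smul (c : ℝ) (F : Matrix (Fin (2 * 4)) (Fin 4) ℝ) : sq⟦c • F⟧ = c ^ 8 • sq⟦F⟧ := by
  funext S S'
  simp only [Pi.smul_apply, smul_eq_mul]
  rw [show (c • F).submatrix S id = c • F.submatrix S id from rfl,
    show (c • F).submatrix S' id = c • F.submatrix S' id from rfl, Matrix.det_smul, Matrix.det_smul,
    Fintype.card_fin]
  ring

/-- `F ↦ Φ(p_F ⊗ p_F)` is continuous (a polynomial in the entries of `F`). [folklore] -/
theorem continuous_apply_sq (Φ : ((Fin 4 → Fin (2 * 4)) → (Fin 4 → Fin (2 * 4)) → ℝ) →ₗ[ℝ] ℝ) :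
    Continuous fun F : Matrix (Fin (2 * 4)) (Fin 4) ℝ => Φ (sq⟦F⟧) := by
  have hΦ : Continuous Φ := Φ.continuous_of_finiteDimensional
  refine hΦ.comp ?_
  refine continuous_pi fun S => continuous_pi fun S' => ?_
  exact ((continuous_id.matrix_submatrix S id).matrix_det).mul
    ((continuous_id.matrix_submatrix S' id).matrix_det)

/-- **Real frames.** A linear functional `≥ 0` on the squares of saturated integer frames is `≥ 0` on the square
`p_F ⊗ p_F` of the Plücker vector of every REAL `8 × 4` matrix `F` (integer frames by §1, rational frames by clearing
denominators, real frames by density of `ℚ` in `ℝ` and continuity). [folklore] -/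
theorem nonneg_realFrameSquare_of_nonneg_frameSquares
    (Φ : ((Fin 4 → Fin (2 * 4)) → (Fin 4 → Fin (2 * 4)) → ℝ) →ₗ[ℝ] ℝ)
    (hΦ : ∀ L : Matrix (Fin (2 * 4)) (Fin 4) ℤ, (∃ M : Matrix (Fin 4) (Fin (2 * 4)) ℤ, M * L = 1) →
      0 ≤ Φ (fun S S' => ((pluckerCoord L S : ℤ) : ℝ) * ((pluckerCoord L S' : ℤ) : ℝ)))
    (F : Matrix (Fin (2 * 4)) (Fin 4) ℝ) : 0 ≤ Φ (sq⟦F⟧) := by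
  -- rational frames
  have hrat : ∀ M : Matrix (Fin (2 * 4)) (Fin 4) ℚ, 0 ≤ Φ (sq⟦M.map ((↑) : ℚ → ℝ)⟧) := by
    intro M
    obtain ⟨d, L, hd, hM⟩ := exists_eq_smul_intCast_of_rat M
    rw [hM, sq_smul, map_smul, smul_eq_mul]
    exact mul_nonneg (pow_nonneg (inv_nonneg.mpr (Nat.cast_nonneg d)) 8)
      (nonneg_intFrameSquare_of_nonneg_frameSquares Φ hΦ L)
  -- density of rational matrices in real matrices
  have hdense : DenseRange (fun M : Matrix (Fin (2 * 4)) (Fin 4) ℚ => M.map ((↑) : ℚ → ℝ)) := by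
    have h := DenseRange.piMap (f := fun (_ : Fin (2 * 4)) (r : Fin 4 → ℚ) => Pi.map (fun _ : Fin 4 => ((↑) : ℚ → ℝ)) r)
      (fun _ => DenseRange.piMap fun _ => Rat.denseRange_cast)
    exact h
  have hclosed : IsClosed {F : Matrix (Fin (2 * 4)) (Fin 4) ℝ | 0 ≤ Φ (sq⟦F⟧)} :=
    isClosed_Ici.preimage (continuous_apply_sq Φ)
  exact hdense.induction_on (p := fun F => 0 ≤ Φ (sq⟦F⟧)) F hclosed hrat

/-! ## §3 Corollary: the boundary ray at every Weil period, with tropical-1's hypothesis verbatim -/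

/-- **No class-positivity constraint separates the boundary ray — at EVERY Weil period.** Every ℝ-linear functional on
the class space that is non-negative on every square `p_L ⊗ p_L` of the Plücker vector of a SATURATED INTEGER frame `L`
(hence, by `Kappa.nonneg_cyc_of_nonneg_frameSquares`, every linear class-level necessary condition for effectivity of
tropical `4`-cycles, at every period) is non-negative on `8 · θ₄(Q) + Re w(Q)` — a class with `W ≠ 0` on the boundary of
the calibration cone `64(q₁² + q₂²) ≤ q₀²` — for EVERY positive definite `Q` commuting with `J`: tropical-1's `Q = 1`
theorem `Kappa.nonneg_boundaryRay_of_nonneg_frameSquares` (κ = 8) holds at all Weil periods, in particular at the very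
general ones of K1. So no argument using only the class `cyc Z` and its positivity proves K1 or narrows the cone there;
a proof of K1 must use the balancing/closing conditions of the TYPE. Decides nothing about K1 or HC.
[cite: Zharkov2020TropicalWeil, §2] [cite: BlekhermanSmithVelasco2016, Thm. 1.1] -/
theorem nonneg_boundaryRay_of_nonneg_frameSquares_allPeriods
    (Φ : ((Fin 4 → Fin (2 * 4)) → (Fin 4 → Fin (2 * 4)) → ℝ) →ₗ[ℝ] ℝ)
    (hΦ : ∀ L : Matrix (Fin (2 * 4)) (Fin 4) ℤ, (∃ M : Matrix (Fin 4) (Fin (2 * 4)) ℤ, M * L = 1) →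
      0 ≤ Φ (fun S S' => ((pluckerCoord L S : ℤ) : ℝ) * ((pluckerCoord L S' : ℤ) : ℝ)))
    (Q : Matrix (Fin (2 * 4)) (Fin (2 * 4)) ℝ) (hQ : Q.PosDef) (hJ : Q * weilJ 4 = weilJ 4 * Q) :
    0 ≤ Φ ((8 : ℝ) • θ⟦4⟧ Q + wRe⟦4⟧ Q) :=
  nonneg_boundaryRay_of_nonneg_realFrameSquares Φ
    (fun F => nonneg_realFrameSquare_of_nonneg_frameSquares Φ hΦ F) Q hQ hJ

end Summit.HodgeConjecture.HodgeConjecture.Theorems.TropicalWeilVanishing.Kappa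

end
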